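import Mathlib
import Summits.KontsevichZagierPeriods.KontsevichZagierPeriods.Theorems.InverseLandauTateFamilyKernelOpenCube
import Summits.KontsevichZagierPeriods.KontsevichZagierPeriods.Theorems.InverseLandauTateFamilyKernelTateAnchor
import Summits.KontsevichZagierPeriods.KontsevichZagierPeriods.Theorems.InverseLandauTateFamilyKernelStubExactFibreTwo
import Summits.KontsevichZagierPeriods.KontsevichZagierPeriods.Theorems.InverseLandauTateFamilyKernelStubGvMoments
import Summits.KontsevichZagierPeriods.KontsevichZagierPeriods.Theorems.InverseLandauTateFamilyKernelStubGvDensity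
import Summits.KontsevichZagierPeriods.KontsevichZagierPeriods.Theorems.InverseLandauTateFamilyKernelStubGwRationalPrimitive
import Summits.KontsevichZagierPeriods.KontsevichZagierPeriods.Theorems.InverseLandauTateFamilyKernelStubGwDivision
import Summits.KontsevichZagierPeriods.KontsevichZagierPeriods.Theorems.InverseLandauTateFamilyKernelStubGwCertificate

/-!
# Crux `TateFamilyKernel` (stmt-KontsevichZagierPeriods-9130), line `Sketch` — the GENERAL-SLOPE
# GRAPH-PENCIL CLASS is a proved sector (glue `gwClass_mem_relations`, completing regime (E1))

The general-slope graph-pencil class of the lead's skeleton of the crux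
`Summit.KontsevichZagierPeriods.KontsevichZagierPeriods.Theses.InverseLandau.TateFamilyKernel`: Tate
denominator `Q = 1 − ϖ·(u(z₂) + v(z₂) z₁)` with `u, v ∈ ℚ[s]` BOTH of arbitrary degree, `u, v > 0`
on `[0,1]`, `W = u + v` strictly increasing on `[0,1]`, `u < W(1)` on `[0,1]`, `W·b ≤ 1` on
`[0,1]`, and a `ϖ`-free numerator `P ∈ ℚ[z₁, z₂]` (variables `z 0 = z₁`, `z 1 = z₂`). If the open-square
fibre integrals `∫_{(0,1)²} P/Q(·, ϖ)` vanish for all `ϖ ∈ (0,b)`, then at every real-algebraic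
`ϖ₀ ∈ (0,b)` every tame cube representation of the fibre `P/Q(·, ϖ₀)` is a Kontsevich–Zagier
relation. The five landed links

1. `stub_gvMoments` (p149291): polynomial test functions of `T = u(z₂) + v(z₂)z₁` are orthogonal
   to `P`;
2. `stub_gvDensity` (p150579): on every `s ∈ (0,1)` with `u < W(s)` on `[0,1]` the single-branch
   pushforward identity `∫_{(s,1)} P((W(s) − u(σ))/v(σ), σ)/v(σ) dσ = 0`;
3. `stub_gwRationalPrimitive` (p152946): on a top interval `(s₁, 1)` where moreover `W′ > 0`, the
   triangular `W′⁻¹ d/ds` elimination forces a RATIONAL primitive `Rn/v^k` of the single-branch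
   integrand (no logarithm survives);
4. `stub_gwDivision` (p152856): the factor theorem gives the twisted identity
   `v^m P = (u′ + v′z₁)∂₀Ñ − v∂₁Ñ + m v′ Ñ` over `ℚ`;
5. `stub_gwCertificate` (p152041): hence `P/Q = ∂₀((u′ + v′z₁)Ñ/D) + ∂₁(−vÑ/D)` with `D = Q·v^m`,
   pointwise wherever `Q ≠ 0` and `v ≠ 0`;

are closed at the fibre by `stub_exactFibreTwo` (p138200): the denominators `D(·, ϖ₀) = Q·v^m` do
not vanish on the closed square, which is all the fibre-level theorem needs (Baker on the
one-variable boundary).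

The only new analytic input of the glue is the THRESHOLD `s₁ ∈ [0,1)` (`GwClass.exists_threshold`):
just below `s = 1` one has simultaneously (a) `u(σ) < W(s)` for all `σ ∈ [0,1]` (a maximum of `u`
on the compact interval and continuity of `W` at `1`, hypothesis `htop`) and (b) `W′(s) > 0`
(`W′ ∈ ℚ[s]` is a nonzero polynomial since `W` is not constant, so it has finitely many real zeros,
none of them just below `1`; and `W′ ≥ 0` on `(0,1)` because `W` is monotone there).

References: Kontsevich–Zagier 2001, §1.2. Mathlib and the landed files above only (helpers
`LinMoments.aeval_snoc_rename_castSucc`, `GwCertificate.aeval_snoc_gwV`,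
`GwCertificate.rename_gwV_pow`); no named fact, no new definition. Helpers live in the
sub-namespace `GwClass`.
-/

noncomputable section

open MeasureTheory Set MvPolynomial
open Literature.NumberTheory.Transcendental

namespace Summit.KontsevichZagierPeriods.InverseLandau.TateFamilyKernel.Descent

namespace GwClass

open Filter Topology

/-! ### Evaluation of the general-slope graph-pencil data at a real point `(w, ϖ)` -/

/-- **The Tate denominator at a real point**: `Q(w, ϖ) = 1 − ϖ·(u(w₂) + v(w₂) w₁)` for
`Q = 1 − X₂·(u(X₁) + v(X₁) X₀)`. [folklore] -/
theorem aeval_gwQ (u v : Polynomial ℚ) (w : Fin 2 → ℝ) (ϖ : ℝ) :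
    aeval (Fin.snoc w ϖ : Fin (2 + 1) → ℝ)
        (1 - X 2 * (Polynomial.aeval (X 1 : MvPolynomial (Fin (2 + 1)) ℚ) u +
          Polynomial.aeval (X 1 : MvPolynomial (Fin (2 + 1)) ℚ) v * X 0)) =
      1 - ϖ * (Polynomial.aeval (w 1) u + Polynomial.aeval (w 1) v * w 0) := by
  have h0 : (Fin.snoc w ϖ : Fin (2 + 1) → ℝ) 0 = w 0 := rfl
  have h2 : (Fin.snoc w ϖ : Fin (2 + 1) → ℝ) 2 = ϖ := rfl
  rw [map_sub, map_one, map_mul, map_add, map_mul, GwCertificate.aeval_snoc_gwV,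
    GwCertificate.aeval_snoc_gwV, aeval_X, aeval_X, h0, h2]

/-- **The Griffiths denominator at a real point**: `D(w, ϖ) = Q(w, ϖ)·v(w₂)^m` for
`D = Q · rename castSucc (v(X₁)^m)`. [folklore] -/
theorem aeval_gwD (u v : Polynomial ℚ) (m : ℕ) (w : Fin 2 → ℝ) (ϖ : ℝ) :
    aeval (Fin.snoc w ϖ : Fin (2 + 1) → ℝ)
        ((1 - X 2 * (Polynomial.aeval (X 1 : MvPolynomial (Fin (2 + 1)) ℚ) u +
          Polynomial.aeval (X 1 : MvPolynomial (Fin (2 + 1)) ℚ) v * X 0)) *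
          rename Fin.castSucc (Polynomial.aeval (X 1 : MvPolynomial (Fin 2) ℚ) v ^ m)) =
      (1 - ϖ * (Polynomial.aeval (w 1) u + Polynomial.aeval (w 1) v * w 0)) *
        Polynomial.aeval (w 1) v ^ m := by
  rw [map_mul, aeval_gwQ, GwCertificate.rename_gwV_pow, map_pow, GwCertificate.aeval_snoc_gwV]

/-- **The fibre integrand**, polynomial form versus real form:
`(rename castSucc P)/Q` at `(w, ϖ)` is `P(w)/(1 − ϖ(u(w₂) + v(w₂) w₁))`. [folklore] -/
theorem fibre_eq (u v : Polynomial ℚ) (P : MvPolynomial (Fin 2) ℚ) (w : Fin 2 → ℝ) (ϖ : ℝ) :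
    aeval (Fin.snoc w ϖ : Fin (2 + 1) → ℝ) (rename Fin.castSucc P) /
        aeval (Fin.snoc w ϖ : Fin (2 + 1) → ℝ)
          (1 - X 2 * (Polynomial.aeval (X 1 : MvPolynomial (Fin (2 + 1)) ℚ) u +
            Polynomial.aeval (X 1 : MvPolynomial (Fin (2 + 1)) ℚ) v * X 0)) =
      aeval w P / (1 - ϖ * (Polynomial.aeval (w 1) u + Polynomial.aeval (w 1) v * w 0)) := by
  rw [aeval_gwQ, LinMoments.aeval_snoc_rename_castSucc]

/-! ### Admissibility: `Q > 0` on the closed square for `ϖ ∈ (0,b)` -/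

/-- On the closed square, `0 < T = u(w₂) + v(w₂) w₁ ≤ (u + v)(w₂)` and `(u + v)(w₂)·b ≤ 1`, so for
`0 < ϖ < b` the Tate denominator `1 − ϖ T` is positive (`ϖ T < b T ≤ 1`). [folklore] -/
theorem gwQ_pos {u v : Polynomial ℚ} {b : ℝ} (hb : 0 < b)
    (hu0 : ∀ s ∈ Icc (0 : ℝ) 1, 0 < Polynomial.aeval s u)
    (hv0 : ∀ s ∈ Icc (0 : ℝ) 1, 0 < Polynomial.aeval s v)
    (hub : ∀ s ∈ Icc (0 : ℝ) 1, (Polynomial.aeval s u + Polynomial.aeval s v) * b ≤ 1)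
    {w : Fin 2 → ℝ} (hw : ∀ t, w t ∈ Icc (0 : ℝ) 1) {ϖ : ℝ} (hϖ : ϖ ∈ Ioo 0 b) :
    0 < 1 - ϖ * (Polynomial.aeval (w 1) u + Polynomial.aeval (w 1) v * w 0) := by
  obtain ⟨h00, h01⟩ := hw 0
  have hu := hu0 (w 1) (hw 1)
  have hv := hv0 (w 1) (hw 1)
  have hT0 : 0 < Polynomial.aeval (w 1) u + Polynomial.aeval (w 1) v * w 0 :=
    add_pos_of_pos_of_nonneg hu (mul_nonneg hv.le h00)
  have h1 : ϖ * (Polynomial.aeval (w 1) u + Polynomial.aeval (w 1) v * w 0) <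
      b * (Polynomial.aeval (w 1) u + Polynomial.aeval (w 1) v * w 0) :=
    mul_lt_mul_of_pos_right hϖ.2 hT0
  have h2 : b * (Polynomial.aeval (w 1) u + Polynomial.aeval (w 1) v * w 0) ≤
      b * (Polynomial.aeval (w 1) u + Polynomial.aeval (w 1) v) :=
    mul_le_mul_of_nonneg_left (by nlinarith [mul_le_of_le_one_right hv.le h01]) hb.le
  have h3 : b * (Polynomial.aeval (w 1) u + Polynomial.aeval (w 1) v) ≤ 1 := by
    rw [mul_comm]
    exact hub (w 1) (hw 1)
  linarith

/-! ### The threshold `s₁`: the top interval `(s₁, 1)` -/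

/-- **(a) `u < W(s)` just below `s = 1`.** If `U < W(1)` on `[0,1]` for continuous `U, W`, then
`U(σ) < W(s)` for all `σ ∈ [0,1]` and all `s` near `1`: a maximum `σ₀` of `U` on the compact
interval and `W(s) → W(1) > U(σ₀)`. [folklore] -/
theorem eventually_forall_lt {U W : ℝ → ℝ} (hU : Continuous U) (hW : Continuous W)
    (htop : ∀ σ ∈ Icc (0 : ℝ) 1, U σ < W 1) :
    ∀ᶠ s in 𝓝 (1 : ℝ), ∀ σ ∈ Icc (0 : ℝ) 1, U σ < W s := by
  obtain ⟨σ₀, hσ₀, hmax⟩ := (isCompact_Icc (a := (0 : ℝ)) (b := 1)).exists_isMaxOn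
    (nonempty_Icc.2 zero_le_one) hU.continuousOn
  filter_upwards [(hW.tendsto 1).eventually_const_lt (htop σ₀ hσ₀)] with s hs σ hσ
  exact (isMaxOn_iff.1 hmax σ hσ).trans_lt hs

/-- **(b) `W′ ≠ 0` just below `s = 1`.** If the real polynomial function of `p ∈ ℚ[s]` is
strictly monotone on `[0,1]`, then `p′ ≠ 0` (otherwise `p` is constant, `p(0) = p(1)`), so the
real zeros of `p′` form a finite set, which the punctured neighbourhood filter of `1` avoids.
[folklore] -/
theorem eventually_aeval_derivative_ne_zero (p : Polynomial ℚ)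
    (hmono : StrictMonoOn (fun s : ℝ => Polynomial.aeval s p) (Icc (0 : ℝ) 1)) :
    ∀ᶠ s in 𝓝[<] (1 : ℝ), Polynomial.aeval s (Polynomial.derivative p) ≠ 0 := by
  -- `p′ ≠ 0`, as a real polynomial
  have hD : (Polynomial.derivative p).map (algebraMap ℚ ℝ) ≠ 0 := by
    intro h0
    rw [Polynomial.map_eq_zero] at h0
    have h01 : Polynomial.aeval (0 : ℝ) p < Polynomial.aeval (1 : ℝ) p :=
      hmono ⟨le_rfl, zero_le_one⟩ ⟨zero_le_one, le_rfl⟩ zero_lt_one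
    rw [Polynomial.eq_C_of_derivative_eq_zero h0, Polynomial.aeval_C, Polynomial.aeval_C] at h01
    exact lt_irrefl _ h01
  -- its real zero set is finite, hence avoided by `𝓝[<] 1 ≤ 𝓝[≠] 1 ≤ cofinite`
  refine (((Polynomial.finite_setOf_isRoot hD).eventually_cofinite_notMem.filter_mono
    (nhdsNE_le_cofinite (1 : ℝ))).filter_mono (nhdsLT_le_nhdsNE 1)).mono fun s hs h => hs ?_
  rwa [mem_setOf_eq, Polynomial.IsRoot.def, Polynomial.eval_map_algebraMap]

/-- **(c) `W′ ≥ 0` inside `(0,1)`, hence `W′ > 0` where `W′ ≠ 0`.** The derivative of the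
monotone function `s ↦ p(s)` within `[0,1]` at an interior point is `p′(s)` and is nonnegative
(`MonotoneOn.derivWithin_nonneg`). [folklore] -/
theorem aeval_derivative_pos {p : Polynomial ℚ}
    (hmono : StrictMonoOn (fun s : ℝ => Polynomial.aeval s p) (Icc (0 : ℝ) 1)) {s : ℝ}
    (hs : s ∈ Ioo (0 : ℝ) 1) (hne : Polynomial.aeval s (Polynomial.derivative p) ≠ 0) :
    0 < Polynomial.aeval s (Polynomial.derivative p) := by
  refine lt_of_le_of_ne ?_ hne.symm
  have h : 0 ≤ derivWithin (fun s : ℝ => Polynomial.aeval s p) (Icc (0 : ℝ) 1) s :=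
    hmono.monotoneOn.derivWithin_nonneg
  rwa [(p.hasDerivWithinAt_aeval s _).derivWithin
    (uniqueDiffOn_Icc zero_lt_one s ⟨hs.1.le, hs.2.le⟩)] at h

/-- **The threshold.** For `u, v ∈ ℚ[s]` with `W = u + v` strictly increasing on `[0,1]` and
`u < W(1)` on `[0,1]` there is `s₁ ∈ [0,1)` such that on the top interval `(s₁, 1)` both
`u(σ) < W(s)` for all `σ ∈ [0,1]` and `W′(s) > 0`: intersect the three eventual properties
`0 < s`, (a) and (b) in `𝓝[<] 1`, extract an interval `(l, 1)`, and upgrade `W′ ≠ 0` to `W′ > 0`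
by (c). [folklore] -/
theorem exists_threshold (u v : Polynomial ℚ)
    (hmono : StrictMonoOn (fun s : ℝ => Polynomial.aeval s u + Polynomial.aeval s v) (Icc (0 : ℝ) 1))
    (htop : ∀ σ ∈ Icc (0 : ℝ) 1, Polynomial.aeval σ u < Polynomial.aeval 1 u + Polynomial.aeval 1 v) :
    ∃ s₁ : ℝ, 0 ≤ s₁ ∧ s₁ < 1 ∧
      (∀ s ∈ Ioo s₁ 1, ∀ σ ∈ Icc (0 : ℝ) 1,
        Polynomial.aeval σ u < Polynomial.aeval s u + Polynomial.aeval s v) ∧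
      ∀ s ∈ Ioo s₁ 1, 0 < Polynomial.aeval s (Polynomial.derivative (u + v)) := by
  have hmono' : StrictMonoOn (fun s : ℝ => Polynomial.aeval s (u + v)) (Icc (0 : ℝ) 1) := by
    simpa only [map_add] using hmono
  have hA : ∀ᶠ s in 𝓝[<] (1 : ℝ), ∀ σ ∈ Icc (0 : ℝ) 1,
      Polynomial.aeval σ u < Polynomial.aeval s u + Polynomial.aeval s v :=
    (eventually_forall_lt (Polynomial.continuous_aeval u)
      ((Polynomial.continuous_aeval u).add (Polynomial.continuous_aeval v)) htop).filter_mono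
      nhdsWithin_le_nhds
  have hB := eventually_aeval_derivative_ne_zero (u + v) hmono'
  have h0 : ∀ᶠ s in 𝓝[<] (1 : ℝ), (0 : ℝ) < s :=
    (lt_mem_nhds one_pos).filter_mono nhdsWithin_le_nhds
  obtain ⟨l, hl, hsub⟩ := mem_nhdsLT_iff_exists_Ioo_subset.1 (h0.and (hA.and hB))
  refine ⟨max 0 l, le_max_left _ _, max_lt one_pos hl, fun s hs => ?_, fun s hs => ?_⟩
  · exact (hsub ⟨(le_max_right _ _).trans_lt hs.1, hs.2⟩).2.1
  · have h := hsub ⟨(le_max_right _ _).trans_lt hs.1, hs.2⟩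
    exact aeval_derivative_pos hmono' ⟨h.1, hs.2⟩ h.2.2

end GwClass

open GwClass in
/-- **Graph pencils with a general polynomial slope are a proved sector of the crux** (dimension 2;
completes regime (E1) of the line's elementary frontier): for `u, v ∈ ℚ[s]` positive on `[0,1]`
with `u + v` strictly increasing and `u < u(1)+v(1)` on `[0,1]`, every real-algebraic fibre of
every identically vanishing `P/(1 − ϖ(u(z₂) + v(z₂)z₁))`, `P ∈ ℚ[z₁,z₂]`, is an effective KZ
relation. Log-free elimination: the triangular `W′⁻¹ d/ds` system forces rational primitives;
factor theorem; fibre-level Griffiths exactness with denominators `Q·v^m`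
(`stub_gvMoments` → `stub_gvDensity` → `GwClass.exists_threshold` → `stub_gwRationalPrimitive` →
`stub_gwDivision` → `stub_gwCertificate` → `stub_exactFibreTwo`).
[cite: KontsevichZagier2001, §1.2] -/
theorem gwClass_mem_relations (u v : Polynomial ℚ) (P : MvPolynomial (Fin 2) ℚ) (b : ℝ) (hb : 0 < b)
    (hu0 : ∀ s ∈ Icc (0 : ℝ) 1, 0 < Polynomial.aeval s u) (hv0 : ∀ s ∈ Icc (0 : ℝ) 1, 0 < Polynomial.aeval s v)
    (hmono : StrictMonoOn (fun s : ℝ => Polynomial.aeval s u + Polynomial.aeval s v) (Icc (0 : ℝ) 1))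
    (htop : ∀ σ ∈ Icc (0 : ℝ) 1, Polynomial.aeval σ u < Polynomial.aeval 1 u + Polynomial.aeval 1 v)
    (hub : ∀ s ∈ Icc (0 : ℝ) 1, (Polynomial.aeval s u + Polynomial.aeval s v) * b ≤ 1)
    (hvan : ∀ ϖ ∈ Ioo 0 b, ∫ z in Set.pi Set.univ (fun _ : Fin 2 => Ioo (0 : ℝ) 1),
      aeval z P / (1 - ϖ * (Polynomial.aeval (z 1) u + Polynomial.aeval (z 1) v * z 0)) = 0)
    (ϖ₀ : ℝ) (halg : IsAlgebraic ℚ ϖ₀) (hϖ₀ : ϖ₀ ∈ Ioo 0 b)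
    (Φ : KZ.IntegralRep 2) (hΦ : Φ.IsTameCube)
    (hΦi : ∀ z ∈ KZ.cube 2, Φ.integrand z =
      aeval z P / (1 - ϖ₀ * (Polynomial.aeval (z 1) u + Polynomial.aeval (z 1) v * z 0))) :
    KZ.of Φ ∈ KZ.relations := by
  -- (1) moments: every polynomial test function of `T = u(z₂) + v(z₂)z₁` is orthogonal to `P`
  have htest := stub_gvMoments u v P b hb hu0 hv0 hub hvan
  -- (2) the threshold `s₁`: on `(s₁, 1)` both `u < W(s)` on `[0,1]` and `W′(s) > 0`
  obtain ⟨s₁, hs₁0, hs₁1, hs₁u, hWpos⟩ := exists_threshold u v hmono htop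
  -- (3) the single-branch pushforward identity on the top interval
  have hzero : ∀ s ∈ Ioo s₁ 1,
      ∫ σ in Ioo s 1, aeval (![(Polynomial.aeval s u + Polynomial.aeval s v - Polynomial.aeval σ u) /
          Polynomial.aeval σ v, σ] : Fin 2 → ℝ) P / Polynomial.aeval σ v = 0 := fun s hs =>
    stub_gvDensity u v P hv0 hmono htest s ⟨hs₁0.trans_lt hs.1, hs.2⟩ (hs₁u s hs)
  -- (4) the rational primitive `Rn/v^k` of the single-branch integrand (log-free elimination)
  have hv : ∀ σ ∈ Icc (0 : ℝ) 1, Polynomial.aeval σ v ≠ 0 := fun σ hσ => (hv0 σ hσ).ne'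
  obtain ⟨Rn, k, hR⟩ := stub_gwRationalPrimitive u v P s₁ hs₁0 hs₁1 hv hWpos hzero
  -- (5) the factor theorem: the twisted identity over `ℚ`
  have hinj : InjOn (fun s : ℝ => Polynomial.aeval s u + Polynomial.aeval s v) (Ioo s₁ 1) :=
    hmono.injOn.mono (Ioo_subset_Icc_self.trans (Icc_subset_Icc hs₁0 le_rfl))
  obtain ⟨Nt, m, hN⟩ := stub_gwDivision u v P Rn k s₁ hs₁0 hs₁1 hv hinj hR hzero
  -- (6) at the fibre `ϖ₀`: `Q ≠ 0`, `D = Q·v^m ≠ 0` on the closed square, and the certificate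
  have hQ : ∀ w ∈ KZ.cube 2, aeval (Fin.snoc w ϖ₀ : Fin (2 + 1) → ℝ)
      (1 - X 2 * (Polynomial.aeval (X 1 : MvPolynomial (Fin (2 + 1)) ℚ) u +
        Polynomial.aeval (X 1 : MvPolynomial (Fin (2 + 1)) ℚ) v * X 0)) ≠ 0 := fun w hw => by
    rw [aeval_gwQ]
    exact (gwQ_pos hb hu0 hv0 hub (fun t => hw t) hϖ₀).ne'
  have hD : ∀ w ∈ KZ.cube 2, aeval (Fin.snoc w ϖ₀ : Fin (2 + 1) → ℝ)
      ((1 - X 2 * (Polynomial.aeval (X 1 : MvPolynomial (Fin (2 + 1)) ℚ) u +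
        Polynomial.aeval (X 1 : MvPolynomial (Fin (2 + 1)) ℚ) v * X 0)) *
        rename Fin.castSucc (Polynomial.aeval (X 1 : MvPolynomial (Fin 2) ℚ) v ^ m)) ≠ 0 :=
    fun w hw => by
      rw [aeval_gwD]
      exact mul_ne_zero (gwQ_pos hb hu0 hv0 hub (fun t => hw t) hϖ₀).ne'
        (pow_ne_zero _ (hv0 (w 1) (hw 1)).ne')
  have hcert := fun w (hw : w ∈ KZ.cube 2) =>
    stub_gwCertificate u v P Nt m hN ϖ₀ w (hv0 (w 1) (hw 1)).ne' (hQ w hw)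
  -- (7) the vanishing open-square integral at `ϖ₀`, in polynomial form
  have hvan₀ : ∫ z in Set.pi Set.univ (fun _ : Fin 2 => Ioo (0 : ℝ) 1),
      aeval (Fin.snoc z ϖ₀ : Fin (2 + 1) → ℝ) (rename Fin.castSucc P) /
        aeval (Fin.snoc z ϖ₀ : Fin (2 + 1) → ℝ)
          (1 - X 2 * (Polynomial.aeval (X 1 : MvPolynomial (Fin (2 + 1)) ℚ) u +
            Polynomial.aeval (X 1 : MvPolynomial (Fin (2 + 1)) ℚ) v * X 0)) = 0 := by
    simp only [fibre_eq]
    exact hvan ϖ₀ hϖ₀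
  -- exactness at the fibre suffices (`stub_exactFibreTwo`, Baker on the one-variable boundary)
  refine stub_exactFibreTwo 2 ![0, 1] (rename Fin.castSucc P)
    (1 - X 2 * (Polynomial.aeval (X 1 : MvPolynomial (Fin (2 + 1)) ℚ) u +
      Polynomial.aeval (X 1 : MvPolynomial (Fin (2 + 1)) ℚ) v * X 0))
    ![rename Fin.castSucc
        ((Polynomial.aeval (X 1 : MvPolynomial (Fin 2) ℚ) (Polynomial.derivative u) +
            Polynomial.aeval (X 1 : MvPolynomial (Fin 2) ℚ) (Polynomial.derivative v) * X 0) * Nt),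
      rename Fin.castSucc (-(Polynomial.aeval (X 1 : MvPolynomial (Fin 2) ℚ) v * Nt))]
    (fun _ => (1 - X 2 * (Polynomial.aeval (X 1 : MvPolynomial (Fin (2 + 1)) ℚ) u +
        Polynomial.aeval (X 1 : MvPolynomial (Fin (2 + 1)) ℚ) v * X 0)) *
      rename Fin.castSucc (Polynomial.aeval (X 1 : MvPolynomial (Fin 2) ℚ) v ^ m))
    ϖ₀ halg hQ (fun _ => hD) (fun w hw => ?_) hvan₀ Φ hΦ (fun z hz => ?_)
  · rw [Fin.sum_univ_two]
    simp only [Matrix.cons_val_zero, Matrix.cons_val_one, Fin.castSucc_zero, Fin.castSucc_one]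
    exact hcert w hw
  · rw [hΦi z hz, fibre_eq]

open GwClass in
/-- The general-slope graph-pencil class in the crux's own binders (`n = 2`, open-square
representation): an identically vanishing family `P/(1 − ϖ(u(z₂) + v(z₂)z₁))` as above has all its
real-algebraic fibres `ϖ₀ ∈ (0,b)` in `KZ.relations` for every representation with domain the open
square and integrand the fibre there (tame-cube form `gwClass_mem_relations` +
`exists_isTameCube_fibre` + `of_mem_relations_of_isTameCube`). [cite: KontsevichZagier2001, §1.2] -/
theorem gwClass_openCube_mem_relations (u v : Polynomial ℚ) (P : MvPolynomial (Fin 2) ℚ)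
    (b : ℝ) (hb : 0 < b)
    (hu0 : ∀ s ∈ Icc (0 : ℝ) 1, 0 < Polynomial.aeval s u)
    (hv0 : ∀ s ∈ Icc (0 : ℝ) 1, 0 < Polynomial.aeval s v)
    (hmono : StrictMonoOn (fun s : ℝ => Polynomial.aeval s u + Polynomial.aeval s v) (Icc (0 : ℝ) 1))
    (htop : ∀ σ ∈ Icc (0 : ℝ) 1, Polynomial.aeval σ u < Polynomial.aeval 1 u + Polynomial.aeval 1 v)
    (hub : ∀ s ∈ Icc (0 : ℝ) 1, (Polynomial.aeval s u + Polynomial.aeval s v) * b ≤ 1)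
    (hvan : ∀ ϖ ∈ Ioo 0 b, ∫ z in Set.pi Set.univ (fun _ : Fin 2 => Ioo (0 : ℝ) 1),
      aeval z P / (1 - ϖ * (Polynomial.aeval (z 1) u + Polynomial.aeval (z 1) v * z 0)) = 0)
    (ϖ₀ : ℝ) (halg : IsAlgebraic ℚ ϖ₀) (hϖ₀ : ϖ₀ ∈ Ioo 0 b)
    (r : KZ.IntegralRep 2) (hd : r.domain = Set.pi Set.univ (fun _ : Fin 2 => Ioo (0 : ℝ) 1))
    (hi : EqOn r.integrand
      (fun z => aeval z P / (1 - ϖ₀ * (Polynomial.aeval (z 1) u + Polynomial.aeval (z 1) v * z 0)))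
      r.domain) :
    KZ.of r ∈ KZ.relations := by
  have hQ : ∀ w ∈ KZ.cube 2, aeval (Fin.snoc w ϖ₀ : Fin (2 + 1) → ℝ)
      (1 - X 2 * (Polynomial.aeval (X 1 : MvPolynomial (Fin (2 + 1)) ℚ) u +
        Polynomial.aeval (X 1 : MvPolynomial (Fin (2 + 1)) ℚ) v * X 0)) ≠ 0 := fun w hw => by
    rw [aeval_gwQ]
    exact (gwQ_pos hb hu0 hv0 hub (fun t => hw t) hϖ₀).ne'
  obtain ⟨Ψ, hΨ, hΨi⟩ := exists_isTameCube_fibre (rename Fin.castSucc P) _ halg hQ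
  have hΨrel : KZ.of Ψ ∈ KZ.relations :=
    gwClass_mem_relations u v P b hb hu0 hv0 hmono htop hub hvan ϖ₀ halg hϖ₀ Ψ hΨ
      (fun z _ => by rw [hΨi]; exact fibre_eq u v P z ϖ₀)
  exact of_mem_relations_of_isTameCube hΨ hΨrel r hd
    (fun z hz => by rw [hΨi]; exact (hi hz).trans (fibre_eq u v P z ϖ₀).symm)

end Summit.KontsevichZagierPeriods.InverseLandau.TateFamilyKernel.Descent
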